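import Summits.SmoothPoincare4.SmoothPoincare4.Theorems.SymplecticOrigamiGromovRecognitionRelEndStubCapModelAux4
import Summits.SmoothPoincare4.SmoothPoincare4.Theorems.SymplecticOrigamiGromovRecognitionRelEndStubCapModelGlueOpens
import Summits.SmoothPoincare4.SmoothPoincare4.Theorems.SymplecticOrigamiGromovRecognitionRelEndStubCapModelGlueForm

/-!
# Wedge cap for `GromovRecognitionRelEnd` — the three coordinate pieces of the cap
(stub `stub_capModel` of line `cross-cap-laurent`, crux `SymplecticOrigami.GromovRecognitionRelEnd`,
item stmt-SmoothPoincare4-11009)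

The cap is glued from three open subsets of `ℂ² = ℝ⁴` (open submanifolds, model `𝓘(ℝ, ℝ⁴)`):
the polydiscs `dV = {|u| < R₁⁻¹} × ℂ_{z₂}` (chart `(u, z₂)`, `u = 1/z₁`, containing the sphere at
infinity `{z₁ = ∞} = {u = 0}` minus one point), `dH = ℂ_{z₁} × {|t| < R₁⁻¹}` (`t = 1/z₂`) and the
bidisc `dC = {|u| < R₁⁻¹} × {|t| < R₁⁻¹}` (the corner `(∞, ∞)`). This file sets up the pieces
`OV, OH, OC : Opens ℝ⁴`, the corestrictions `mkV, mkH, mkC`, the constant complex structure `i ⊕ i`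
on each piece (`JV, JH, JC`, restrictions of `AlmostComplexStructure.ofModel I4`), the cap forms
`βV = ΩV|_{OV}`, `βH`, `βC` (smooth, closed, taming), and the calculus of "piece maps"
`mk ∘ F ∘ val` between pieces (`mfderiv_pieceMap`, `pullback_pieceMap`).
-/

noncomputable section

-- the registered namespace `Summit.SmoothPoincare4.SmoothPoincare4.Theorems…` repeats a component
set_option linter.dupNamespace false

open scoped Manifold ContDiff Topology
open Set Function Filter TopologicalSpace Literature.Geometry.Kaehler Literature.Geometry.Symplectic

namespace Summit.SmoothPoincare4.SmoothPoincare4.Theorems.GromovRecognitionRelEnd.CrossCapLaurent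

namespace CapModel

/-- Model space `ℝ⁴ = ℂ²` (coordinates `0,1` = `z₁`, `2,3` = `z₂`). -/
local notation "E4" => EuclideanSpace ℝ (Fin 4)

/-! ## The three polydiscs -/

/-- `dV = {|u|² < R₁⁻²}` (chart `(u, z₂)` of the sphere `{z₁ = ∞}`), literally as in the signature. [folklore] -/
def dV (R₁ : ℝ) : Set E4 := {p | p 0 ^ 2 + p 1 ^ 2 < R₁⁻¹ ^ 2}
/-- `dH = {|t|² < R₁⁻²}` (chart `(z₁, t)` of the sphere `{z₂ = ∞}`). [folklore] -/
def dH (R₁ : ℝ) : Set E4 := {p | p 2 ^ 2 + p 3 ^ 2 < R₁⁻¹ ^ 2}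
/-- `dC = {|u|² < R₁⁻²} × {|t|² < R₁⁻²}` (chart `(u, t)` of the corner). [folklore] -/
def dC (R₁ : ℝ) : Set E4 := {p | p 0 ^ 2 + p 1 ^ 2 < R₁⁻¹ ^ 2 ∧ p 2 ^ 2 + p 3 ^ 2 < R₁⁻¹ ^ 2}

variable {R₁ : ℝ}

/-- Membership in `dV`. [folklore] -/
theorem mem_dV {p : E4} : p ∈ dV R₁ ↔ r1 p < R₁⁻¹ ^ 2 := Iff.rfl
/-- Membership in `dH`. [folklore] -/
theorem mem_dH {p : E4} : p ∈ dH R₁ ↔ r2 p < R₁⁻¹ ^ 2 := Iff.rfl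
/-- Membership in `dC`. [folklore] -/
theorem mem_dC {p : E4} : p ∈ dC R₁ ↔ r1 p < R₁⁻¹ ^ 2 ∧ r2 p < R₁⁻¹ ^ 2 := Iff.rfl

variable (R₁) in
/-- `dV` is open. [folklore] -/
theorem isOpen_dV : IsOpen (dV R₁) := isOpen_lt continuous_r1 continuous_const
variable (R₁) in
/-- `dH` is open. [folklore] -/
theorem isOpen_dH : IsOpen (dH R₁) := isOpen_lt continuous_r2 continuous_const
variable (R₁) in
/-- `dC` is open. [folklore] -/
theorem isOpen_dC : IsOpen (dC R₁) := (isOpen_dV R₁).inter (isOpen_dH R₁)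

variable (R₁) in
/-- The piece `OV` as an open submanifold of `ℝ⁴`. [folklore] -/
def OV : Opens E4 := ⟨dV R₁, isOpen_dV R₁⟩
variable (R₁) in
/-- The piece `OH` as an open submanifold of `ℝ⁴`. [folklore] -/
def OH : Opens E4 := ⟨dH R₁, isOpen_dH R₁⟩
variable (R₁) in
/-- The piece `OC` as an open submanifold of `ℝ⁴`. [folklore] -/
def OC : Opens E4 := ⟨dC R₁, isOpen_dC R₁⟩

/-- Membership in `OV`. [folklore] -/
theorem mem_OV {p : E4} : p ∈ OV R₁ ↔ r1 p < R₁⁻¹ ^ 2 := Iff.rfl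
/-- Membership in `OH`. [folklore] -/
theorem mem_OH {p : E4} : p ∈ OH R₁ ↔ r2 p < R₁⁻¹ ^ 2 := Iff.rfl
/-- Membership in `OC`. [folklore] -/
theorem mem_OC {p : E4} : p ∈ OC R₁ ↔ r1 p < R₁⁻¹ ^ 2 ∧ r2 p < R₁⁻¹ ^ 2 := Iff.rfl

variable [hR : Fact (0 < R₁)]

/-- `R₁⁻² > 0`. [folklore] -/
theorem invSq_pos : 0 < R₁⁻¹ ^ 2 := by have := hR.out; positivity

/-- The origin of the `V`-chart (a point of the sphere at infinity). [folklore] -/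
def oV : OV R₁ := ⟨0, by rw [mem_OV, r1_def]; simpa using invSq_pos⟩
/-- The origin of the `H`-chart. [folklore] -/
def oH : OH R₁ := ⟨0, by rw [mem_OH, r2_def]; simpa using invSq_pos⟩
/-- The origin of the corner chart (the corner `(∞, ∞)`). [folklore] -/
def oC : OC R₁ := ⟨0, by rw [mem_OC, r1_def, r2_def]; simpa using invSq_pos⟩

/-- `instance`: the pieces are nonempty. [folklore] -/
instance : Nonempty (OV R₁) := ⟨oV⟩
/-- `instance`: the pieces are nonempty. [folklore] -/
instance : Nonempty (OH R₁) := ⟨oH⟩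
/-- `instance`: the pieces are nonempty. [folklore] -/
instance : Nonempty (OC R₁) := ⟨oC⟩

/-- Corestriction `ℝ⁴ → OV` (junk: the origin, off `dV`). [folklore] -/
def mkV : E4 → OV R₁ := toOpens (OV R₁) oV
/-- Corestriction `ℝ⁴ → OH`. [folklore] -/
def mkH : E4 → OH R₁ := toOpens (OH R₁) oH
/-- Corestriction `ℝ⁴ → OC`. [folklore] -/
def mkC : E4 → OC R₁ := toOpens (OC R₁) oC

/-! ## The constant complex structure `i ⊕ i` on the pieces -/

omit hR in
/-- `i ⊕ i` as a (constant) almost complex structure on `ℝ⁴`. [cite: McDuffSalamon2017, §2.5] -/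
def J4 : AlmostComplexStructure 𝓘(ℝ, E4) ∞ E4 := AlmostComplexStructure.ofModel 𝓘(ℝ, E4) ∞ I4 I4_I4

omit hR in
/-- `J4` is `I4` on every tangent space. [folklore] -/
@[simp] theorem J4_apply (p : E4) (v : E4) : J4 p v = I4 v := rfl

variable (R₁) in
/-- `i ⊕ i` on the piece `OV`. [folklore] -/
def JV : AlmostComplexStructure 𝓘(ℝ, E4) ∞ (OV R₁) := acsRestrict J4 (OV R₁)
variable (R₁) in
/-- `i ⊕ i` on the piece `OH`. [folklore] -/
def JH : AlmostComplexStructure 𝓘(ℝ, E4) ∞ (OH R₁) := acsRestrict J4 (OH R₁)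
variable (R₁) in
/-- `i ⊕ i` on the piece `OC`. [folklore] -/
def JC : AlmostComplexStructure 𝓘(ℝ, E4) ∞ (OC R₁) := acsRestrict J4 (OC R₁)

omit hR in
/-- `JV` is `I4`. [folklore] -/
@[simp] theorem JV_apply (b : OV R₁) (v : E4) : JV R₁ b v = I4 v := rfl
omit hR in
/-- `JH` is `I4`. [folklore] -/
@[simp] theorem JH_apply (b : OH R₁) (v : E4) : JH R₁ b v = I4 v := rfl
omit hR in
/-- `JC` is `I4`. [folklore] -/
@[simp] theorem JC_apply (b : OC R₁) (v : E4) : JC R₁ b v = I4 v := rfl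

/-! ## The cap forms on the pieces -/

variable (R₁) in
/-- The cap form on `OV`: `ΩV` read on the open submanifold. [folklore] -/
def βV : MForm 𝓘(ℝ, E4) (OV R₁) ℝ 2 := (ΩV R₁).pullback 𝓘(ℝ, E4) Subtype.val
variable (R₁) in
/-- The cap form on `OH`. [folklore] -/
def βH : MForm 𝓘(ℝ, E4) (OH R₁) ℝ 2 := (ΩH R₁).pullback 𝓘(ℝ, E4) Subtype.val
variable (R₁) in
/-- The cap form on `OC`. [folklore] -/
def βC : MForm 𝓘(ℝ, E4) (OC R₁) ℝ 2 := (ΩC R₁).pullback 𝓘(ℝ, E4) Subtype.val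

omit hR in
/-- A smooth closed form restricts to a smooth closed form on an open submanifold of `ℝ⁴`.
[cite: WarnerGTM94, Prop. 2.23] -/
theorem isClosedForm_pullback_val {U : Opens E4} {β : MForm (𝓡 4) E4 ℝ 2} (hs : IsSmoothForm β)
    (hc : IsClosedForm β) : IsClosedForm (β.pullback 𝓘(ℝ, E4) (Subtype.val : U → E4)) := by
  funext x
  ext v
  rw [mextDeriv_pullback_subtypeVal_apply (hs _), show mextDeriv β = 0 from hc]
  rfl

omit hR in
/-- The cap forms on the pieces are smooth and closed. [folklore] -/
theorem βVHC_smooth_closed :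
    (IsSmoothForm (βV R₁) ∧ IsClosedForm (βV R₁)) ∧ (IsSmoothForm (βH R₁) ∧ IsClosedForm (βH R₁)) ∧
      (IsSmoothForm (βC R₁) ∧ IsClosedForm (βC R₁)) := by
  obtain ⟨-, hV, hH, hC⟩ := isSmoothForm_models R₁
  obtain ⟨-, hV', hH', hC'⟩ := isClosedForm_models R₁
  exact ⟨⟨hV.pullback_subtypeVal, isClosedForm_pullback_val hV hV'⟩,
    ⟨hH.pullback_subtypeVal, isClosedForm_pullback_val hH hH'⟩,
    ⟨hC.pullback_subtypeVal, isClosedForm_pullback_val hC hC'⟩⟩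

omit hR in
/-- The cap forms tame `i ⊕ i` on the pieces. [cite: McDuffSalamon2017, §4.1 (4.1.1)] -/
theorem βVHC_tame : (JV R₁).IsTamedBy (βV R₁) ∧ (JH R₁).IsTamedBy (βH R₁) ∧
    (JC R₁).IsTamedBy (βC R₁) := by
  refine ⟨fun b v hv => ?_, fun b v hv => ?_, fun b v hv => ?_⟩
  · rw [βV, MForm.pullback_subtypeVal_apply, JV_apply]; exact (models_I4_pos R₁ b.1 hv).2.1
  · rw [βH, MForm.pullback_subtypeVal_apply, JH_apply]; exact (models_I4_pos R₁ b.1 hv).2.2.1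
  · rw [βC, MForm.pullback_subtypeVal_apply, JC_apply]; exact (models_I4_pos R₁ b.1 hv).2.2.2

/-! ## Piece maps `mk ∘ F ∘ val` -/

omit hR in
/-- The differential of the inclusion of a piece, on model-space vectors. [folklore] -/
theorem mfderiv_val_apply' {U : Opens E4} (b : U) (v : E4) :
    mfderiv 𝓘(ℝ, E4) 𝓘(ℝ, E4) (Subtype.val : U → E4) b v = v :=
  mfderiv_val_apply b v

omit hR in
/-- **Smoothness of a piece map.** If `F : ℝ⁴ → ℝ⁴` is `C^∞` at `b.1` then
`toOpens U' x₀ ∘ F ∘ val` is `C^∞` at `b` whenever `F b.1 ∈ U'`. [folklore] -/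
theorem contMDiffAt_pieceMap {U U' : Opens E4} {x₀ : U'} {F : E4 → E4} {b : U}
    (hF : ContDiffAt ℝ ∞ F b.1) (hb : F b.1 ∈ U') :
    ContMDiffAt 𝓘(ℝ, E4) 𝓘(ℝ, E4) ∞ (toOpens U' x₀ ∘ F ∘ Subtype.val) b :=
  (contMDiffAt_toOpens hb).comp b (hF.contMDiffAt.comp b contMDiff_subtype_val.contMDiffAt)

omit hR in
/-- **Differential of a piece map**: `d(mk ∘ F ∘ val)_b v = DF(b.1) v`. [folklore] -/
theorem mfderiv_pieceMap {U U' : Opens E4} {x₀ : U'} {F : E4 → E4} {b : U}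
    (hF : ContDiffAt ℝ ∞ F b.1) (hb : F b.1 ∈ U') (v : E4) :
    mfderiv 𝓘(ℝ, E4) 𝓘(ℝ, E4) (toOpens U' x₀ ∘ F ∘ Subtype.val) b v = fderiv ℝ F b.1 v := by
  have h1 : MDifferentiableAt 𝓘(ℝ, E4) 𝓘(ℝ, E4) (toOpens U' x₀) (F b.1) :=
    (contMDiffAt_toOpens hb).mdifferentiableAt (by simp)
  have h2 : MDifferentiableAt 𝓘(ℝ, E4) 𝓘(ℝ, E4) F b.1 :=
    hF.contMDiffAt.mdifferentiableAt (by simp)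
  have h3 : MDifferentiableAt 𝓘(ℝ, E4) 𝓘(ℝ, E4) (Subtype.val : U → E4) b :=
    Literature.Geometry.Manifold.OpenSubmanifold.mdifferentiableAt_subtype_val b
  rw [mfderiv_comp b h1 (h2.comp b h3), mfderiv_comp b h2 h3]
  show mfderiv 𝓘(ℝ, E4) 𝓘(ℝ, E4) (toOpens U' x₀) (F b.1)
    (mfderiv 𝓘(ℝ, E4) 𝓘(ℝ, E4) F b.1 (mfderiv 𝓘(ℝ, E4) 𝓘(ℝ, E4) Subtype.val b v)) = _
  rw [mfderiv_toOpens_apply hb, mfderiv_val_apply, mfderiv_eq_fderiv]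
  rfl

omit hR in
/-- **Pull-back along a piece map**: `(mk ∘ F ∘ val)^* (β|_{U'}) = (F^* β)|_U` at `b`. [folklore] -/
theorem pullback_pieceMap {U U' : Opens E4} {x₀ : U'} {F : E4 → E4} {b : U}
    (hF : ContDiffAt ℝ ∞ F b.1) (hb : F b.1 ∈ U') (β : MForm (𝓡 4) E4 ℝ 2) :
    (β.pullback 𝓘(ℝ, E4) (Subtype.val : U' → E4)).pullback 𝓘(ℝ, E4)
        (toOpens U' x₀ ∘ F ∘ Subtype.val) b = β.pullback 𝓘(ℝ, E4) F b.1 := by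
  ext u
  show β ((toOpens U' x₀ ∘ F ∘ Subtype.val) b).1 (fun i => mfderiv 𝓘(ℝ, E4) 𝓘(ℝ, E4)
      (Subtype.val : U' → E4) ((toOpens U' x₀ ∘ F ∘ Subtype.val) b)
      (mfderiv 𝓘(ℝ, E4) 𝓘(ℝ, E4) (toOpens U' x₀ ∘ F ∘ Subtype.val) b (u i))) =
    β (F b.1) (fun i => mfderiv 𝓘(ℝ, E4) 𝓘(ℝ, E4) F b.1 (u i))
  simp only [mfderiv_pieceMap hF hb, mfderiv_val_apply', mfderiv_eq_fderiv]
  exact MForm.congr_point β (val_toOpens (x₀ := x₀) hb) _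

omit hR in
/-- Pointwise chain rule for pull-backs of forms on `ℝ⁴`. [folklore] -/
theorem pullback_comp_apply_pt (β : MForm (𝓡 4) E4 ℝ 2) {F G : E4 → E4} {p : E4}
    (hG : DifferentiableAt ℝ G (F p)) (hF : DifferentiableAt ℝ F p) :
    β.pullback 𝓘(ℝ, E4) (G ∘ F) p = (β.pullback 𝓘(ℝ, E4) G).pullback 𝓘(ℝ, E4) F p := by
  ext u
  simp only [MForm.pullback_apply, Function.comp_apply,
    mfderiv_comp p hG.mdifferentiableAt hF.mdifferentiableAt]
  rfl

end CapModel

/-- **Registered helper sub-goal `helper_capModelConstACSOnOpens`** (file `Cap1` of stub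
`stub_capModel`): every open subset of `ℝ⁴` carries the constant almost complex structure `i ⊕ i`
(as a `C^∞` section of its endomorphism bundle). [cite: McDuffSalamon2017, §2.5] -/
theorem helper_capModelConstACSOnOpens : ∀ (U : TopologicalSpace.Opens (EuclideanSpace ℝ (Fin 4))),
    ∃ J : Literature.Geometry.Symplectic.AlmostComplexStructure (𝓡 4) ∞ U,
      ∀ (u : U) (v : EuclideanSpace ℝ (Fin 4)), J u v = WithLp.toLp 2 ![-(v 1), v 0, -(v 3), v 2] :=
  fun U => ⟨CapModel.acsRestrict CapModel.J4 U, fun _ _ => rfl⟩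

end Summit.SmoothPoincare4.SmoothPoincare4.Theorems.GromovRecognitionRelEnd.CrossCapLaurent
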